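import Mathlib
import HarnessLib
import Summits.ValiantsHypothesis.ValiantsHypothesis.Theses.MonotoneRestoration
import Summits.ValiantsHypothesis.ValiantsHypothesis.Theorems.MonotoneRestorationCruxToTarget
import Summits.ValiantsHypothesis.ValiantsHypothesis.Theorems.MonotoneRestorationMonotoneRestorationQPSymmetricLB
import Literature.ModelTheory.FiniteModelTheory.CkEquiv
import Literature.ModelTheory.FiniteModelTheory.SymmetricCircuitCountingWidthProofs
import Literature.Computability.AlgebraicComplexity.SymmetricThresholdTranslation

/-!
# Route MonotoneRestoration — support `WidthKillsRestoration` (the kill glue)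

Item `stmt-ValiantsHypothesis-17620` (support of route `MonotoneRestoration`):

`PolylogWidthMonotoneEasy → ¬ MonotoneRestorationQP`.

A monotone-easy matrix-symmetric family `f` whose complexification separates, for every `c` and
beyond every `N`, two `C^{(log₂ m + c)^c}`-equivalent graphs on `Fin m` cannot have
square-symmetric circuits of quasi-polynomial size `2^{(log₂ n + c')^{c'}}`.  The argument is
PER ORDER `m` (no class of graphs, no asymptotics beyond the choice of a large `m`):

* the crux gives a square-symmetric circuit `C_m` over `ℂ` of size `≤ 2^{(log₂ m + c')^{c'}}`
  computing `map f_m`;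
* Dawar–Wilsenach, Thm 5.1 (`LabelledArithCircuit.thresholdCircuit`, PROVED in the tree) translates
  it into a square-symmetric threshold circuit `Ψ` deciding "`map f_m (A) = map f_m (X)`" on `0/1`
  matrices `A`, of orbit size `≤ |C_m| + m² + 1` (`thresholdCircuit_orbitSize_le`,
  `orbitSize_le_size`);
* rigidification with the Support Theorem attached (`exists_reduced_rigidification_supports`,
  PROVED): the same function, orbit size `+ m²`, and supports of size `≤ k` as soon as `8 < m`,
  `1 ≤ k`, `k + 1 ≤ m/4` and the orbit size is `≤ C(m, k)`; we take `k := (log₂ m + c₃)^{c₃}` with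
  `c₃` the bookkeeping exponent of `monotoneRestoration_cruxToTarget_size_le 2 c'`
  (`2^{(log₂ m + c')^{c'}} + (m+2)² + m·m + 16 ≤ 2^k`) and `2^k ≤ C(m, k)`
  (`two_pow_le_choose_of_two_mul_le`), `m` being large (`8k < m`, `symmetricLB_logPow_lt`);
* Anderson–Dawar / Dawar–Wilsenach §6 (`eval_adjInput_eq_of_ckEquiv`, PROVED): supports of size
  `≤ k` force equal outputs on `C^{2k+2}`-equivalent graphs; the witness pair at level
  `(log₂ m + c₃ + 2)^{c₃ + 2} ≥ 2k + 2` (`widthKillsRestoration_level_le`, `CkEquiv.mono`) therefore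
  has `map f_m (Y) = map f_m (X)` — contradicting the separation.

Template: `Theorems.stub_symmetricLB_of_linearCountingWidth` (the `o(n)` version of the pipeline).
Sources: DawarWilsenach2025 (Thm 5.1, §6, proof of Thm 7.1), AndersonDawar2016 (Thm 6). Pure
composition of tree theorems and `Nat.log` arithmetic; no named fact, nothing vendored.
-/

-- single-problem summit: `Summit.ValiantsHypothesis.ValiantsHypothesis.…` is the namespace by design (D-0017)
set_option linter.dupNamespace false

namespace Summit.ValiantsHypothesis.ValiantsHypothesis.Theorems

open Summit.ValiantsHypothesis.ValiantsHypothesis.Theses.MonotoneRestoration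
open Literature.Computability.AlgebraicComplexity
open Literature.Computability.Complexity
open Literature.ModelTheory.FiniteModelTheory

/-- **Level bookkeeping**: `2 (L + c₃)^{c₃} + 2 ≤ (L + (c₃ + 2))^{c₃ + 2}` — the pebble number
`2k + 2` of `eval_adjInput_eq_of_ckEquiv` for `k = (L + c₃)^{c₃}` is dominated by the witness level
with exponent `c₃ + 2`. [folklore] -/
theorem widthKillsRestoration_level_le (L c₃ : ℕ) :
    2 * (L + c₃) ^ c₃ + 2 ≤ (L + (c₃ + 2)) ^ (c₃ + 2) := by
  have h1 : 1 ≤ (L + c₃) ^ c₃ := by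
    rcases Nat.eq_zero_or_pos c₃ with h | h
    · subst h; simp
    · exact Nat.one_le_pow _ _ (by omega)
  have h2 : (L + c₃) ^ c₃ ≤ (L + (c₃ + 2)) ^ c₃ := Nat.pow_le_pow_left (by omega) _
  have h3 : 4 ≤ (L + (c₃ + 2)) ^ 2 := by
    calc 4 = 2 ^ 2 := by norm_num
      _ ≤ (L + (c₃ + 2)) ^ 2 := Nat.pow_le_pow_left (by omega) _
  calc 2 * (L + c₃) ^ c₃ + 2 ≤ 4 * (L + c₃) ^ c₃ := by omega
    _ ≤ (L + (c₃ + 2)) ^ 2 * (L + (c₃ + 2)) ^ c₃ := Nat.mul_le_mul h3 h2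
    _ = (L + (c₃ + 2)) ^ (c₃ + 2) := by rw [← pow_add, add_comm 2 c₃]

/-- **WidthKillsRestoration** (item `stmt-ValiantsHypothesis-17620`, support of route
MonotoneRestoration — the kill glue): `PolylogWidthMonotoneEasy → ¬ MonotoneRestorationQP`.
Per order `m`: crux circuit → symmetric threshold circuit deciding the value at `X`
(Dawar–Wilsenach Thm 5.1) → reduced rigidification with supports of size
`≤ k = (log₂ m + c₃)^{c₃}` (Support Theorem, `2^{(log₂ m+c')^{c'}} + 2m² + 1 ≤ 2^k ≤ C(m,k)`) →
equal outputs on the `C^{2k+2}`-equivalent witness pair (Anderson–Dawar Thm 6) → the values of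
`map f_m` at `X` and `Y` coincide, contradicting the separation.
[cite: DawarWilsenach2025, Thm 5.1, §6 and §7.1 (proof of Thm 7.1); AndersonDawar2016, Thm 6] -/
theorem widthKillsRestoration_proof : WidthKillsRestoration := by
  unfold WidthKillsRestoration
  rintro ⟨f, hfsymm, hfeasy, hsep⟩ hQP
  classical
  -- the quasi-polynomial square-symmetric circuits of the crux
  obtain ⟨c', hc'⟩ := hQP f hfsymm hfeasy
  -- bookkeeping exponent: `2^((L+c')^c') + (m+2)^2 + m*m + 16 ≤ 2^((L+c₃)^c₃)`
  obtain ⟨c₃, hc₃⟩ := monotoneRestoration_cruxToTarget_size_le 2 c'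
  -- the order threshold: `(L + c₃)^c₃ < m/8` for `m ≥ 2^k₀`
  obtain ⟨k₀, hk₀⟩ := symmetricLB_logPow_lt c₃ (δ := 1 / 8) (by norm_num)
  -- the witness pair at level `(L + (c₃+2))^(c₃+2)`, of order `m ≥ 2^k₀`
  obtain ⟨m, hNm, X, Y, hXY, hne⟩ := hsep (c₃ + 2) (2 ^ k₀)
  obtain ⟨G, inst, C, hCsym, hCeval, hCcard⟩ := hc' m
  -- the support size `k`
  obtain ⟨k, hk⟩ : ∃ k : ℕ, k = (Nat.log 2 m + c₃) ^ c₃ := ⟨_, rfl⟩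
  have hkR : (k : ℝ) = ((Nat.log 2 m : ℝ) + c₃) ^ c₃ := by
    rw [hk, Nat.cast_pow, Nat.cast_add]
  -- `m` is large: `8k < m`
  have h8k : 8 * k < m := by
    have h := hk₀ m hNm
    have h' : ((8 * k : ℕ) : ℝ) < (m : ℝ) := by
      push_cast
      rw [hkR]
      linarith
    exact_mod_cast h'
  have hk1 : 1 ≤ k := by
    rcases Nat.eq_zero_or_pos c₃ with h0 | hpos
    · simp [hk, h0]
    · rw [hk]
      exact Nat.one_le_pow _ _ (by omega)
  have hm8 : 8 < m := by omega
  have hk4 : k + 1 ≤ m / 4 := (Nat.le_div_iff_mul_le (by norm_num)).2 (by omega)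
  have h2k : 2 * k ≤ m := by omega
  -- the value of the circuit polynomial at (the adjacency matrix of) `X`
  obtain ⟨vX, hvX⟩ : ∃ v : ℂ, v = MvPolynomial.eval
      (fun ij => if adjInput X ij = true then (1 : ℂ) else 0) (C.eval (C.output ())) := ⟨_, rfl⟩
  -- Dawar–Wilsenach Thm 5.1: the symmetric threshold circuit deciding "value `= vX`"
  obtain ⟨Ψ, hΨ⟩ : ∃ Ψ : Circuit (Fin m × Fin m), Ψ = C.thresholdCircuit ({vX} : Set ℂ) :=
    ⟨_, rfl⟩
  have hΨB : Ψ.IsOver tcBasis := by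
    rw [hΨ]
    exact C.thresholdCircuit_isOver _
  have hΨsym : Ψ.IsSymmetricUnder Set.univ := by
    rw [hΨ]
    exact C.thresholdCircuit_isSymmetricUnder _ hCsym
  have hΨeval : ∀ A : Fin m × Fin m → Bool, Ψ.eval A = true ↔
      MvPolynomial.eval (fun ij => if A ij = true then (1 : ℂ) else 0) (C.eval (C.output ())) ∈
        ({vX} : Set ℂ) := by
    intro A
    rw [hΨ]
    exact C.thresholdCircuit_eval _ A
  have hΨorb : Ψ.orbitSize Set.univ ≤ C.orbitSize (Equiv.Perm (Fin m)) + m ^ 2 + 1 := by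
    rw [hΨ]
    exact C.thresholdCircuit_orbitSize_le _ hCsym
  have hCorb : C.orbitSize (Equiv.Perm (Fin m)) ≤ Fintype.card G := C.orbitSize_le_size _
  -- reduced rigidification with the Support Theorem attached
  obtain ⟨C', hC'B, hC'sym, hC'eval, hC'orb, hC'supp⟩ :=
    exists_reduced_rigidification_supports Ψ hΨB hΨsym
  have horbk : C'.orbitSize Set.univ ≤ m.choose k := by
    have hmm : m ^ 2 = m * m := sq m
    have hm2 : (m + 2) ^ 2 = m * m + 4 * m + 4 := by ring
    calc C'.orbitSize Set.univ
        ≤ 2 ^ ((Nat.log 2 m + c') ^ c') + (m + 2) ^ 2 + m * m + 16 := by omega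
      _ ≤ 2 ^ ((Nat.log 2 m + c₃) ^ c₃) := hc₃ m
      _ = 2 ^ k := by rw [hk]
      _ ≤ m.choose k := two_pow_le_choose_of_two_mul_le h2k
  have hsupp := hC'supp hm8 k hk1 hk4 horbk
  -- Anderson–Dawar: equal outputs on the `C^{2k+2}`-equivalent witness pair
  have hXY' : CkEquiv (2 * k + 2) X Y := by
    refine hXY.mono ?_
    rw [hk]
    exact widthKillsRestoration_level_le _ _
  have heq : C'.eval (adjInput X) = C'.eval (adjInput Y) :=
    eval_adjInput_eq_of_ckEquiv hC'B hC'sym hsupp hXY'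
  -- read back through `Ψ`: the value at `Y` lies in `{vX}`
  have hX : Ψ.eval (adjInput X) = true := by
    rw [hΨeval, hvX]
    exact Set.mem_singleton _
  have hY : Ψ.eval (adjInput Y) = true := by
    rw [← hC'eval, ← heq, hC'eval]
    exact hX
  rw [hΨeval, Set.mem_singleton_iff, hvX, hCeval] at hY
  -- Boolean inputs are the indicators of the statement; contradiction with the separation
  apply hne
  have hind : ∀ Γ : SimpleGraph (Fin m),
      Set.indicator {ij : Fin m × Fin m | Γ.Adj ij.1 ij.2} (1 : Fin m × Fin m → ℂ) =
        fun ij : Fin m × Fin m => if adjInput Γ ij = true then (1 : ℂ) else 0 := by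
    intro Γ
    funext ij
    by_cases h : Γ.Adj ij.1 ij.2 <;> simp [h, adjInput_apply]
  rw [hind X, hind Y]
  exact hY.symm

end Summit.ValiantsHypothesis.ValiantsHypothesis.Theorems
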